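import Summits.FinalStateConjecture.FinalStateConjecture.Theses.PhotonSphereChannels
import Summits.FinalStateConjecture.FinalStateConjecture.Theorems.PhotonSphereChannelsTameEternalLimitDefs
import Summits.FinalStateConjecture.FinalStateConjecture.Theorems.ZeroEnergyKerrOrBombStationaryLimitReductionOneDevelopment
import Summits.FinalStateConjecture.FinalStateConjecture.Theorems.PhaseMixingCaptureWeakCosmicCensorshipMGHDCompleteNullInfinityInvariant
import Summits.FinalStateConjecture.FinalStateConjecture.Theorems.EIHFluxBalanceModulatedKerrHandoffStubRaysStayInClosureTransport
import Summits.FinalStateConjecture.FinalStateConjecture.Theorems.EIHFluxBalanceModulatedKerrHandoffStubRayTransport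
import Literature.Geometry.Lorentzian.MGHDUniqueness
import Literature.Geometry.Lorentzian.AdmissibleMGHDExistence
import HarnessLib

/-!
# The crux `ChannelsResolveTameDevelopmentsR` (K2R-T2, item `stmt-FinalStateConjecture-17430`) is a statement
# about ISOMETRY CLASSES of maximal developments: its hypotheses (i), (ii) and its conclusion are transported
# along isometries of developments, so ONE maximal development per datum decides it
# (route PhotonSphereChannels; single-development collapse)

The crux inspects, for every admissible datum `D`, EVERY maximal vacuum Cauchy development `𝒟` of `D`:
complete `𝓘⁺` and the standing hypotheses (i) no extremal remnant (`TrappedSet.NoExtremalRemnant`) and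
(ii) tame outer region (`TrappedSet.TameOuterRegion`) are to force the T2 conclusion (an honest `C²`
final-state decomposition of the self-determined exterior, rays staying, exhaustive future-oriented
charts). By the Choquet-Bruhat–Geroch uniqueness theorem (`VacuumCauchyDevelopment.isIsometricTo_of_isMaximal'`,
proved in the tree) any two MGHDs of `D` are isometric AS DEVELOPMENTS (a time-orientation preserving
isometric diffeomorphism `ψ` with `ψ ∘ ι₁ = ι₂`). This file proves that every ingredient of the crux body
is an invariant of that relation:

* `noExtremalRemnant_iff_of_isIsometricTo` — (i): an extremal late chart `Ψ` into `𝒟₂` with vanishing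
  truncated `C²` deviations pulls back to `ψ⁻¹ ∘ Ψ` into `𝒟₁` with the SAME deviations
  (`OneLockedExplosion.isLateChart_comp`, `truncDeviationCk_comp`, `isIsometry_symm`);
* `image_outerRegion` — the outer region `J⁺(ι X) ∩ ⋃ I⁻(complete rays)` is carried by `ψ`
  (`image_causalFuture_eq`, `image_chronologicalPast_eq`, and the ray correspondence
  `EIHFluxBalance.TameTemplate.stub_rayTransport`);
* `tameOuterRegion_iff_of_isIsometricTo` — (ii): the `(r₀, Λ)`-tame flat charts `Ψ` at the points of
  the outer region of `𝒟₁` push forward to `ψ ∘ Ψ`, late charts with literally the same deviation tensor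
  (`Spacetime.deviation_comp`), at the points of the outer region of `𝒟₂`;
* `conclusion_of_isometry` / `conclusion_iff_of_isIsometricTo` — the T2 conclusion is transported
  (`transportDecomposition`, `image_exteriorOf`, `hasExhaustiveCharts_transportDecomposition`, rays by
  `stub_raysStayInClosure_transport`, future orientation by the chain rule and the timecone lemma);
* `body_iff_of_isIsometricTo` — hence the whole per-development BODY of the crux is an invariant;
* `channelsResolveTameDevelopmentsR_iff_exists_isMaximal` — **SINGLE-DEVELOPMENT COLLAPSE**: the crux
  is equivalent to "K1R → for every admissible datum, either it has no MGHD or SOME MGHD satisfies the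
  body", and, given `choquetBruhat_geroch_exists_mghd_cauchy`, to "… SOME MGHD satisfies the body"
  (`channelsResolveTameDevelopmentsR_iff_exists_isMaximal_of_cbg`);
* `tameQ_iff_exists_isMaximal` — the same collapse for the per-datum property of the sibling crux
  `TameCensorship` (K3, item `stmt-FinalStateConjecture-17431`): "an MGHD exists and every MGHD has
  complete `𝓘⁺`, (i), (ii)" iff "some MGHD has complete `𝓘⁺`, (i), (ii)".

So a proof — or a refutation — of the crux at a datum may be run in ANY convenient maximal development
of it (e.g. the geodesically complete one when it exists, cf. `TrivialDatum.settlesT2_of_isMaximal`).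
Mathlib + built tree modules only; no `sorry`, no new definitions. References: Choquet-Bruhat–Geroch,
CMP 14 (1969), Thm. 3; O'Neill, *Semi-Riemannian Geometry* (1983), Ch. 3 pp. 58, 90–91, Ch. 5 p. 145,
Ch. 14 pp. 402–403; Sbierski, Ann. Henri Poincaré 17 (2016), §2–§3; Dafermos–Luk, arXiv:1710.01722,
§1.2.1 and Conjecture 1.
-/

noncomputable section

-- every `Summit.FinalStateConjecture.FinalStateConjecture.…` name repeats the summit = sub-problem segment (D-0017 layout)
set_option linter.dupNamespace false

open Set Filter Function TopologicalSpace
open scoped Manifold ContDiff Topology ENNReal NNReal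

namespace Summit.FinalStateConjecture.FinalStateConjecture.Theorems.ChannelsResolveTameDevelopmentsR.SingleDevelopment

open Literature.Geometry.Lorentzian
open Summit.FinalStateConjecture (HasCompleteNullInfinity exteriorOf RaysStayInClosure HasExhaustiveCharts
  IsFutureOriented)
open Summit.FinalStateConjecture.FinalStateConjecture.Theses.PhotonSphereChannels
  (UniformPhotonSphereChannelsR ChannelsResolveTameDevelopmentsR)
open Summit.FinalStateConjecture.FinalStateConjecture.Theorems.TrappedSet
  (NoExtremalRemnant TameOuterRegion outerRegion)
open Summit.FinalStateConjecture.FinalStateConjecture.Theorems.OneLockedExplosion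
  (transportDecomposition charted_transportDecomposition mdifferentiable_diffeomorph isIsometry_symm
    preservesTimeOrientation_symm image_causalFuture_eq image_chronologicalPast_eq truncDeviationCk_comp
    isLateChart_comp image_exteriorOf hasExhaustiveCharts_transportDecomposition)
open Summit.FinalStateConjecture.FinalStateConjecture.Theorems.PhaseMixingCapture.WeakCosmicCensorshipMGHD
  (hasCompleteNullInfinity_iff_of_isIsometricTo)
open Summit.FinalStateConjecture.FinalStateConjecture.Theorems.EIHFluxBalance.TameTemplate
  (stub_raysStayInClosure_transport stub_rayTransport)

/-! ### §1 Future orientation of the charts rides along an isometry (chain rule + timecone lemma) -/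

/-- Future orientation of a final-state decomposition is transported along a time-orientation
preserving isometric diffeomorphism: motions are kept, charts become `ψ ∘ Ψ`, and `dψ` maps
future-directed causal vectors to future-directed causal vectors. [cite: ONeillSemiRiemannian1983, Ch. 5, p. 145] -/
private theorem isFutureOriented_transport {𝓢₁ 𝓢₂ : Spacetime.{0} 4}
    (ψ : Diffeomorph (𝓡 4) (𝓡 4) 𝓢₁.carrier 𝓢₂.carrier ∞)
    (hiso : 𝓢₁.metric.IsIsometry 𝓢₂.metric.toPseudoRiemannianMetric ψ)
    (hτ : 𝓢₁.timeOrientation.PreservesTimeOrientation ψ 𝓢₂.timeOrientation)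
    {O : Set 𝓢₁.carrier} {k : ℕ} (d : FinalStateDecomposition 𝓢₁ O k) (h : IsFutureOriented d) :
    IsFutureOriented (transportDecomposition ψ hiso hτ d) := by
  have step : ∀ {U : Opens E4} {Ψ : U → 𝓢₁.carrier}, ContMDiff 𝓘(ℝ, E4) (𝓡 4) ∞ Ψ →
      ∀ {x : U} {v : E4}, 𝓢₁.timeOrientation.IsFutureDirected (mfderiv 𝓘(ℝ, E4) (𝓡 4) Ψ x v) →
        𝓢₂.timeOrientation.IsFutureDirected (mfderiv 𝓘(ℝ, E4) (𝓡 4) (ψ ∘ Ψ) x v) := by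
    intro U Ψ hΨ x v hv
    have hc : MDifferentiableAt 𝓘(ℝ, E4) (𝓡 4) Ψ x := (hΨ.mdifferentiable (by simp)) x
    rw [mfderiv_comp x (mdifferentiable_diffeomorph ψ _) hc]
    exact hτ.isFutureDirected_mfderiv hiso hv
  obtain ⟨h₁, h₂, h₃⟩ := h
  refine ⟨h₁, fun i ρ ↦ (h₂ i ρ).mono fun τ hτ' x hx ↦ ?_, h₃.mono fun τ hτ' x hx ↦ ?_⟩
  · exact step (d.isLateChart i).contMDiff (hτ' x hx)
  · exact step d.isLateChart_flat.contMDiff (hτ' x hx)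

/-! ### §2 The packages of an isometry of developments -/

section Transport

variable {X : Type} [TopologicalSpace X] [ChartedSpace E3 X] [IsManifold (𝓡 3) ∞ X] [T2Space X]
  [SecondCountableTopology X] [ConnectedSpace X] {D : InitialDataSet (𝓡 3) X}
  {𝒟₁ 𝒟₂ : VacuumCauchyDevelopment D}
  (ψ : Diffeomorph (𝓡 4) (𝓡 4) 𝒟₁.carrier 𝒟₂.carrier ∞)
  (hiso : 𝒟₁.metric.IsIsometry 𝒟₂.metric.toPseudoRiemannianMetric ψ)
  (hτ : 𝒟₁.timeOrientation.PreservesTimeOrientation ψ 𝒟₂.timeOrientation)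
  (hι : ψ ∘ 𝒟₁.embed = 𝒟₂.embed)

omit [T2Space X] [SecondCountableTopology X] in
include hι in
/-- The inverse of an isometry of developments commutes with the embeddings: `ψ⁻¹ ∘ ι₂ = ι₁`.
[cite: Sbierski2016AHP, §2, Remark (1) after the definition of a CGHD] -/
theorem symm_comp_embed : ψ.symm ∘ 𝒟₂.embed = 𝒟₁.embed := by
  funext x
  have h := congrFun hι x
  simp only [Function.comp_apply] at h ⊢
  rw [← h, Diffeomorph.symm_apply_apply]

include hiso hτ hι in
/-- **The T2 conclusion of the crux is transported along an isometry of developments.** An honest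
`C²` decomposition `d` of `O = exteriorOf 𝒟₁ d.charted` with rays staying, exhaustive and
future-oriented charts pushes forward to `transportDecomposition ψ d` of `ψ(O) = exteriorOf 𝒟₂ ψ(charted)`
(`image_exteriorOf`) with the same three properties (`stub_raysStayInClosure_transport` with the ray
correspondence `stub_rayTransport`; `hasExhaustiveCharts_transportDecomposition`; chain rule + timecone
lemma). [cite: ChoquetBruhatGeroch1969CMP, Thm. 3 (pp. 332–334)] -/
theorem conclusion_of_isometry
    (h : ∃ (O : Set 𝒟₁.carrier) (d : FinalStateDecomposition 𝒟₁.toSpacetime O 2),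
      O = exteriorOf 𝒟₁.toCauchyDevelopment d.charted ∧ RaysStayInClosure 𝒟₁.toCauchyDevelopment O ∧
        HasExhaustiveCharts d ∧ IsFutureOriented d) :
    ∃ (O : Set 𝒟₂.carrier) (d : FinalStateDecomposition 𝒟₂.toSpacetime O 2),
      O = exteriorOf 𝒟₂.toCauchyDevelopment d.charted ∧ RaysStayInClosure 𝒟₂.toCauchyDevelopment O ∧
        HasExhaustiveCharts d ∧ IsFutureOriented d := by
  obtain ⟨O, d, hO, hrays, hex, hfo⟩ := h
  refine ⟨ψ '' O, transportDecomposition (𝓢₁ := 𝒟₁.toSpacetime) (𝓢₂ := 𝒟₂.toSpacetime) ψ hiso hτ d,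
    ?_, ?_, hasExhaustiveCharts_transportDecomposition _ hiso hτ d hex,
    isFutureOriented_transport _ hiso hτ d hfo⟩
  · rw [charted_transportDecomposition, ← image_exteriorOf ψ hiso hτ hι, ← hO]
  · exact stub_raysStayInClosure_transport X D 𝒟₁ 𝒟₂ ψ hiso hτ hι
      (fun p γ dom ↦ stub_rayTransport X D 𝒟₁ 𝒟₂ ψ hiso hτ hι p γ dom) O hrays

omit [T2Space X] [SecondCountableTopology X] in
include hiso in
/-- **Hypothesis (i) pulls back along an isometry of developments**: an extremal boosted-Kerr late chart
`Ψ` into `𝒟₂` whose truncated `C²` deviations tend to `0` on every near-zone slab gives the chart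
`ψ⁻¹ ∘ Ψ` into `𝒟₁` with literally the same truncated deviations (`ψ⁻¹` is an isometric diffeomorphism,
`isIsometry_symm`, `truncDeviationCk_comp`, `isLateChart_comp`). So (i) for `𝒟₁` gives (i) for `𝒟₂`.
[cite: ONeillSemiRiemannian1983, Ch. 3, Def. 3.4 (p. 58)] -/
theorem noExtremalRemnant_of_isometry (h : NoExtremalRemnant 𝒟₁) : NoExtremalRemnant 𝒟₂ := by
  intro Λ c M a hext hex
  obtain ⟨τ₀, Ψ, hlate, hdev⟩ := hex
  have hiso' := isIsometry_symm (𝓢₁ := 𝒟₁.toSpacetime) (𝓢₂ := 𝒟₂.toSpacetime) ψ hiso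
  have hlate' : 𝒟₁.toSpacetime.IsLateChart (boostedKerrBackground Λ c M a) Set.univ τ₀ (ψ.symm ∘ Ψ) := by
    have h1 := isLateChart_comp (𝓢₁ := 𝒟₂.toSpacetime) (𝓢₂ := 𝒟₁.toSpacetime) ψ.symm
      (boostedKerrBackground Λ c M a) hlate
    have hsurj : Function.Surjective (ψ.symm : 𝒟₂.carrier → 𝒟₁.carrier) :=
      fun y ↦ ⟨ψ y, ψ.symm_apply_apply y⟩
    rwa [Set.image_univ_of_surjective hsurj] at h1
  refine h Λ c M a hext ⟨τ₀, ψ.symm ∘ Ψ, hlate', fun R ↦ ?_⟩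
  refine (hdev R).congr fun t ↦ ?_
  exact (truncDeviationCk_comp (𝓢₁ := 𝒟₂.toSpacetime) (𝓢₂ := 𝒟₁.toSpacetime) ψ.symm
    (boostedKerrBackground Λ c M a) hlate.contMDiff hiso' 2 R t).symm

include hiso hτ hι in
/-- **The outer region is carried into the outer region**: `ψ(J⁺(ι₁ X) ∩ ⋃ I⁻(complete rays of 𝒟₁))
⊆ J⁺(ι₂ X) ∩ ⋃ I⁻(complete rays of 𝒟₂)` — causal futures and chronological pasts are transported
(`image_causalFuture_eq`, `image_chronologicalPast_eq`), `ψ(ι₁ X) = ι₂ X`, and `ψ ∘ γ` is a normalised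
null ray of `𝒟₂` from `p` on the same domain when `γ` is one of `𝒟₁` (`stub_rayTransport`).
[cite: ONeillSemiRiemannian1983, Ch. 14, pp. 402–403] -/
theorem image_outerRegion_subset [𝒟₁.metric.HasLeviCivita] [𝒟₂.metric.HasLeviCivita] :
    ψ '' outerRegion 𝒟₁.toCauchyDevelopment ⊆ outerRegion 𝒟₂.toCauchyDevelopment := by
  rintro _ ⟨q, ⟨hqJ, p, γ, dom, hγ, hdom, hqI⟩, rfl⟩
  refine ⟨?_, p, ψ ∘ γ, dom, (stub_rayTransport X D 𝒟₁ 𝒟₂ ψ hiso hτ hι p γ dom).2 hγ, hdom, ?_⟩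
  · have h1 : ψ q ∈ ψ '' 𝒟₁.metric.causalFuture 𝒟₁.timeOrientation (Set.range 𝒟₁.embed) :=
      Set.mem_image_of_mem _ hqJ
    rwa [image_causalFuture_eq (𝓢₁ := 𝒟₁.toSpacetime) (𝓢₂ := 𝒟₂.toSpacetime) ψ hiso hτ,
      ← Set.range_comp, hι] at h1
  · have h2 : ψ q ∈ ψ '' 𝒟₁.metric.chronologicalPast 𝒟₁.timeOrientation (γ '' (dom ∩ Set.Ici 0)) :=
      Set.mem_image_of_mem _ hqI
    rwa [image_chronologicalPast_eq (𝓢₁ := 𝒟₁.toSpacetime) (𝓢₂ := 𝒟₂.toSpacetime) ψ hiso hτ,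
      Set.image_image] at h2

include hiso hτ hι in
/-- **The outer region is transported**: `ψ(outer(𝒟₁)) = outer(𝒟₂)` (the inclusion for `ψ` and for the
inverse package `ψ⁻¹`). [cite: ONeillSemiRiemannian1983, Ch. 14, pp. 402–403] -/
theorem image_outerRegion [𝒟₁.metric.HasLeviCivita] [𝒟₂.metric.HasLeviCivita] :
    ψ '' outerRegion 𝒟₁.toCauchyDevelopment = outerRegion 𝒟₂.toCauchyDevelopment := by
  refine Set.Subset.antisymm (image_outerRegion_subset ψ hiso hτ hι) fun q hq ↦ ?_
  have h := image_outerRegion_subset (𝒟₁ := 𝒟₂) (𝒟₂ := 𝒟₁) ψ.symm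
    (isIsometry_symm (𝓢₁ := 𝒟₁.toSpacetime) (𝓢₂ := 𝒟₂.toSpacetime) ψ hiso)
    (preservesTimeOrientation_symm (𝓢₁ := 𝒟₁.toSpacetime) (𝓢₂ := 𝒟₂.toSpacetime) ψ hiso hτ)
    (symm_comp_embed ψ hι) (Set.mem_image_of_mem ψ.symm hq)
  exact ⟨ψ.symm q, h, ψ.apply_symm_apply q⟩

include hiso hτ hι in
/-- **Hypothesis (ii) is transported along an isometry of developments.** Given `(r₀, Λ)`-tame flat
charts at the points of the outer region of `𝒟₁`: a point `q` of the outer region of `𝒟₂` is `ψ q₁`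
with `q₁ = ψ⁻¹ q` in the outer region of `𝒟₁` (`image_outerRegion`); the chart `Ψ` at `q₁` pushes
forward to the late chart `ψ ∘ Ψ` (`isLateChart_comp`) centred at `q`, whose deviation tensor from `η`
is literally that of `Ψ` (`Spacetime.deviation_comp`), so both sup-norm bounds are kept.
[cite: ONeillSemiRiemannian1983, Ch. 3, Def. 3.4 (p. 58)] -/
theorem tameOuterRegion_of_isometry (h : TameOuterRegion 𝒟₁) : TameOuterRegion 𝒟₂ := by
  intro inst₂
  haveI inst₁ : 𝒟₁.metric.HasLeviCivita := 𝒟₁.metric.toPseudoRiemannianMetric.hasLeviCivita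
  obtain ⟨r₀, hr₀, Λ, hch⟩ := @h inst₁
  refine ⟨r₀, hr₀, Λ, fun q hq ↦ ?_⟩
  -- `q = ψ q₁` with `q₁` in the outer region of `𝒟₁`
  have hq' : q ∈ ψ '' outerRegion 𝒟₁.toCauchyDevelopment := by
    rw [image_outerRegion ψ hiso hτ hι]; exact hq
  obtain ⟨q₁, hq₁, rfl⟩ := hq'
  obtain ⟨Ψ, hlate, ⟨x, hx0, hxq⟩, h3, h0⟩ := hch q₁ hq₁
  have hlate' : 𝒟₂.toSpacetime.IsLateChart
      (Minkowski.backgroundOn ⟨Metric.ball (0 : E4) r₀, Metric.isOpen_ball⟩) Set.univ (-r₀) (ψ ∘ Ψ) := by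
    have h1 := isLateChart_comp (𝓢₁ := 𝒟₁.toSpacetime) (𝓢₂ := 𝒟₂.toSpacetime) ψ
      (Minkowski.backgroundOn ⟨Metric.ball (0 : E4) r₀, Metric.isOpen_ball⟩) hlate
    have hsurj : Function.Surjective (ψ : 𝒟₁.carrier → 𝒟₂.carrier) :=
      fun z ↦ ⟨ψ.symm z, ψ.apply_symm_apply z⟩
    rwa [Set.image_univ_of_surjective hsurj] at h1
  have hdev : 𝒟₂.toSpacetime.deviationExtend
      (Minkowski.backgroundOn ⟨Metric.ball (0 : E4) r₀, Metric.isOpen_ball⟩) (ψ ∘ Ψ) =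
        𝒟₁.toSpacetime.deviationExtend
          (Minkowski.backgroundOn ⟨Metric.ball (0 : E4) r₀, Metric.isOpen_ball⟩) Ψ := by
    unfold Spacetime.deviationExtend
    rw [Spacetime.deviation_comp _ (mdifferentiable_diffeomorph ψ) hiso
      (hlate.contMDiff.mdifferentiable (by simp))]
  refine ⟨ψ ∘ Ψ, hlate', ⟨x, hx0, by simp only [Function.comp_apply, hxq]⟩, ?_, ?_⟩
  · show supCkENorm ((⟨Metric.ball (0 : E4) r₀, Metric.isOpen_ball⟩ : Opens E4) : Set E4) 3
        (𝒟₂.toSpacetime.deviationExtend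
          (Minkowski.backgroundOn ⟨Metric.ball (0 : E4) r₀, Metric.isOpen_ball⟩) (ψ ∘ Ψ)) ≤ (Λ : ℝ≥0∞)
    rw [hdev]; exact h3
  · show supCkENorm ((⟨Metric.ball (0 : E4) r₀, Metric.isOpen_ball⟩ : Opens E4) : Set E4) 0
        (𝒟₂.toSpacetime.deviationExtend
          (Minkowski.backgroundOn ⟨Metric.ball (0 : E4) r₀, Metric.isOpen_ball⟩) (ψ ∘ Ψ)) ≤ 1 / 2
    rw [hdev]; exact h0

end Transport

/-! ### §3 Invariance under `IsIsometricTo` and the single-development collapse -/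

section Collapse

variable {X : Type} [TopologicalSpace X] [ChartedSpace E3 X] [IsManifold (𝓡 3) ∞ X] [T2Space X]
  [SecondCountableTopology X] [ConnectedSpace X] {D : InitialDataSet (𝓡 3) X}
  {𝒟₁ 𝒟₂ : VacuumCauchyDevelopment D}

omit [T2Space X] [SecondCountableTopology X] in
/-- (i) is a property of the isometry class of a development. [cite: ChoquetBruhatGeroch1969CMP, Thm. 3 (pp. 332–334)] -/
theorem noExtremalRemnant_iff_of_isIsometricTo
    (h : 𝒟₁.toCauchyDevelopment.IsIsometricTo 𝒟₂.toCauchyDevelopment) :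
    NoExtremalRemnant 𝒟₁ ↔ NoExtremalRemnant 𝒟₂ := by
  constructor
  · obtain ⟨ψ, hiso, -, -⟩ := h
    exact noExtremalRemnant_of_isometry ψ hiso
  · obtain ⟨ψ, hiso, -, -⟩ := h.symm
    exact noExtremalRemnant_of_isometry ψ hiso

/-- (ii) is a property of the isometry class of a development. [cite: ChoquetBruhatGeroch1969CMP, Thm. 3 (pp. 332–334)] -/
theorem tameOuterRegion_iff_of_isIsometricTo
    (h : 𝒟₁.toCauchyDevelopment.IsIsometricTo 𝒟₂.toCauchyDevelopment) :
    TameOuterRegion 𝒟₁ ↔ TameOuterRegion 𝒟₂ := by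
  constructor
  · obtain ⟨ψ, hiso, hτ, hι⟩ := h
    exact tameOuterRegion_of_isometry ψ hiso hτ hι
  · obtain ⟨ψ, hiso, hτ, hι⟩ := h.symm
    exact tameOuterRegion_of_isometry ψ hiso hτ hι

/-- The T2 conclusion of the crux is a property of the isometry class of a development.
[cite: ChoquetBruhatGeroch1969CMP, Thm. 3 (pp. 332–334)] -/
theorem conclusion_iff_of_isIsometricTo
    (h : 𝒟₁.toCauchyDevelopment.IsIsometricTo 𝒟₂.toCauchyDevelopment) :
    (∃ (O : Set 𝒟₁.carrier) (d : FinalStateDecomposition 𝒟₁.toSpacetime O 2),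
      O = exteriorOf 𝒟₁.toCauchyDevelopment d.charted ∧ RaysStayInClosure 𝒟₁.toCauchyDevelopment O ∧
        HasExhaustiveCharts d ∧ IsFutureOriented d) ↔
    ∃ (O : Set 𝒟₂.carrier) (d : FinalStateDecomposition 𝒟₂.toSpacetime O 2),
      O = exteriorOf 𝒟₂.toCauchyDevelopment d.charted ∧ RaysStayInClosure 𝒟₂.toCauchyDevelopment O ∧
        HasExhaustiveCharts d ∧ IsFutureOriented d := by
  constructor
  · obtain ⟨ψ, hiso, hτ, hι⟩ := h
    exact conclusion_of_isometry ψ hiso hτ hι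
  · obtain ⟨ψ, hiso, hτ, hι⟩ := h.symm
    exact conclusion_of_isometry ψ hiso hτ hι

/-- **The per-development BODY of the crux is a property of the isometry class of a development**:
complete `𝓘⁺` (`hasCompleteNullInfinity_iff_of_isIsometricTo`), (i), (ii) and the conclusion are all
invariants. [cite: ChoquetBruhatGeroch1969CMP, Thm. 3 (pp. 332–334)] -/
theorem body_iff_of_isIsometricTo
    (h : 𝒟₁.toCauchyDevelopment.IsIsometricTo 𝒟₂.toCauchyDevelopment) :
    (HasCompleteNullInfinity 𝒟₁.toCauchyDevelopment → (NoExtremalRemnant 𝒟₁ ∧ TameOuterRegion 𝒟₁) →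
      ∃ (O : Set 𝒟₁.carrier) (d : FinalStateDecomposition 𝒟₁.toSpacetime O 2),
        O = exteriorOf 𝒟₁.toCauchyDevelopment d.charted ∧ RaysStayInClosure 𝒟₁.toCauchyDevelopment O ∧
          HasExhaustiveCharts d ∧ IsFutureOriented d) ↔
    (HasCompleteNullInfinity 𝒟₂.toCauchyDevelopment → (NoExtremalRemnant 𝒟₂ ∧ TameOuterRegion 𝒟₂) →
      ∃ (O : Set 𝒟₂.carrier) (d : FinalStateDecomposition 𝒟₂.toSpacetime O 2),
        O = exteriorOf 𝒟₂.toCauchyDevelopment d.charted ∧ RaysStayInClosure 𝒟₂.toCauchyDevelopment O ∧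
          HasExhaustiveCharts d ∧ IsFutureOriented d) := by
  rw [hasCompleteNullInfinity_iff_of_isIsometricTo _ _ h, noExtremalRemnant_iff_of_isIsometricTo h,
    tameOuterRegion_iff_of_isIsometricTo h, conclusion_iff_of_isIsometricTo h]

end Collapse

/-- **SINGLE-DEVELOPMENT COLLAPSE OF THE CRUX.** `ChannelsResolveTameDevelopmentsR` — "K1R ⇒ for every
admissible datum and EVERY maximal development: complete `𝓘⁺`, (i), (ii) ⇒ T2 conclusion" — is
equivalent to "K1R ⇒ for every admissible datum, either no MGHD exists or SOME MGHD satisfies the body":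
any two MGHDs of a datum are isometric as developments (`VacuumCauchyDevelopment.isIsometricTo_of_isMaximal'`,
Choquet-Bruhat–Geroch) and the body is an invariant (`body_iff_of_isIsometricTo`).
[cite: ChoquetBruhatGeroch1969CMP, Thm. 3 (pp. 332–334)] -/
theorem channelsResolveTameDevelopmentsR_iff_exists_isMaximal :
    ChannelsResolveTameDevelopmentsR ↔
      (UniformPhotonSphereChannelsR → ∀ (X : Type) [TopologicalSpace X] [ChartedSpace E3 X]
        [IsManifold (𝓡 3) ∞ X] [T2Space X] [SecondCountableTopology X] [ConnectedSpace X],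
        ∀ D ∈ admissibleVacuumData X,
          (∀ 𝒟 : VacuumCauchyDevelopment D, ¬ 𝒟.IsMaximal) ∨
            ∃ 𝒟 : VacuumCauchyDevelopment D, 𝒟.IsMaximal ∧
              (HasCompleteNullInfinity 𝒟.toCauchyDevelopment →
                (NoExtremalRemnant 𝒟 ∧ TameOuterRegion 𝒟) →
                  ∃ (O : Set 𝒟.carrier) (d : FinalStateDecomposition 𝒟.toSpacetime O 2),
                    O = exteriorOf 𝒟.toCauchyDevelopment d.charted ∧
                      RaysStayInClosure 𝒟.toCauchyDevelopment O ∧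
                        HasExhaustiveCharts d ∧ IsFutureOriented d)) := by
  constructor
  · intro h h₁ X _ _ _ _ _ _ D hD
    by_cases hex : ∃ 𝒟 : VacuumCauchyDevelopment D, 𝒟.IsMaximal
    · obtain ⟨𝒟, h𝒟⟩ := hex
      exact Or.inr ⟨𝒟, h𝒟, fun hI hyp ↦ h h₁ X D hD 𝒟 h𝒟 hI hyp⟩
    · exact Or.inl fun 𝒟 h𝒟 ↦ hex ⟨𝒟, h𝒟⟩
  · intro h h₁ X _ _ _ _ _ _ D hD 𝒟 h𝒟 hI hyp
    rcases h h₁ X D hD with hnone | ⟨𝒟₀, h𝒟₀, hbody⟩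
    · exact absurd h𝒟 (hnone 𝒟)
    · exact (body_iff_of_isIsometricTo
        (VacuumCauchyDevelopment.isIsometricTo_of_isMaximal' h𝒟₀ h𝒟)).1 hbody hI hyp

/-- **Single-development collapse, given MGHD existence.** Under `choquetBruhat_geroch_exists_mghd_cauchy`
(every admissible datum has an MGHD, `exists_isMaximal_of_mem_admissibleVacuumData`) the crux is
equivalent to "K1R ⇒ for every admissible datum SOME maximal development satisfies the body".
[cite: ChoquetBruhatGeroch1969CMP, Thm. 3 (p. 332)] -/
theorem channelsResolveTameDevelopmentsR_iff_exists_isMaximal_of_cbg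
    (hcbg : choquetBruhat_geroch_exists_mghd_cauchy) :
    ChannelsResolveTameDevelopmentsR ↔
      (UniformPhotonSphereChannelsR → ∀ (X : Type) [TopologicalSpace X] [ChartedSpace E3 X]
        [IsManifold (𝓡 3) ∞ X] [T2Space X] [SecondCountableTopology X] [ConnectedSpace X],
        ∀ D ∈ admissibleVacuumData X,
          ∃ 𝒟 : VacuumCauchyDevelopment D, 𝒟.IsMaximal ∧
            (HasCompleteNullInfinity 𝒟.toCauchyDevelopment →
              (NoExtremalRemnant 𝒟 ∧ TameOuterRegion 𝒟) →
                ∃ (O : Set 𝒟.carrier) (d : FinalStateDecomposition 𝒟.toSpacetime O 2),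
                  O = exteriorOf 𝒟.toCauchyDevelopment d.charted ∧
                    RaysStayInClosure 𝒟.toCauchyDevelopment O ∧
                      HasExhaustiveCharts d ∧ IsFutureOriented d)) := by
  rw [channelsResolveTameDevelopmentsR_iff_exists_isMaximal]
  refine ⟨fun h h₁ X _ _ _ _ _ _ D hD ↦ ?_, fun h h₁ X _ _ _ _ _ _ D hD ↦ Or.inr (h h₁ X D hD)⟩
  rcases h h₁ X D hD with hnone | hsome
  · obtain ⟨𝒟, h𝒟⟩ := hcbg.exists_isMaximal_of_mem_admissibleVacuumData hD
    exact absurd h𝒟 (hnone 𝒟)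
  · exact hsome

/-- **The same collapse for the sibling crux K3** (`TameCensorship`, item `stmt-FinalStateConjecture-17431`),
whose tame-generic property at a datum `D` is `Q(D)` = "an MGHD exists AND every MGHD has complete `𝓘⁺`,
(i) and (ii)": `Q(D)` holds iff SOME maximal development of `D` has complete `𝓘⁺`, (i) and (ii)
(MGHD uniqueness up to isometry + invariance of the three clauses). [cite: ChoquetBruhatGeroch1969CMP, Thm. 3 (pp. 332–334)] -/
theorem tameQ_iff_exists_isMaximal {X : Type} [TopologicalSpace X] [ChartedSpace E3 X]
    [IsManifold (𝓡 3) ∞ X] [T2Space X] [SecondCountableTopology X] [ConnectedSpace X]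
    (D : InitialDataSet (𝓡 3) X) :
    ((∃ 𝒟 : VacuumCauchyDevelopment D, 𝒟.IsMaximal) ∧
        ∀ 𝒟 : VacuumCauchyDevelopment D, 𝒟.IsMaximal →
          HasCompleteNullInfinity 𝒟.toCauchyDevelopment ∧ NoExtremalRemnant 𝒟 ∧ TameOuterRegion 𝒟) ↔
      ∃ 𝒟 : VacuumCauchyDevelopment D, 𝒟.IsMaximal ∧
        HasCompleteNullInfinity 𝒟.toCauchyDevelopment ∧ NoExtremalRemnant 𝒟 ∧ TameOuterRegion 𝒟 := by
  constructor
  · rintro ⟨⟨𝒟, h𝒟⟩, hall⟩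
    exact ⟨𝒟, h𝒟, hall 𝒟 h𝒟⟩
  · rintro ⟨𝒟₀, h𝒟₀, hI, hi, hii⟩
    refine ⟨⟨𝒟₀, h𝒟₀⟩, fun 𝒟 h𝒟 ↦ ?_⟩
    have h := VacuumCauchyDevelopment.isIsometricTo_of_isMaximal' h𝒟₀ h𝒟
    exact ⟨(hasCompleteNullInfinity_iff_of_isIsometricTo _ _ h).1 hI,
      (noExtremalRemnant_iff_of_isIsometricTo h).1 hi, (tameOuterRegion_iff_of_isIsometricTo h).1 hii⟩

end Summit.FinalStateConjecture.FinalStateConjecture.Theorems.ChannelsResolveTameDevelopmentsR.SingleDevelopment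

end
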